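import Summits.AtomisticToContinuum.FouriersLaw.Theses.CageBudgetFekete
import Summits.AtomisticToContinuum.FouriersLaw.Theorems.EmbeddedDrudeMourreMourreDissolutionCosineBochner

/-!
# Birth skeleton — crux `HeatVarianceCeiling` (stmt-AtomisticToContinuum-15770)

Route `route-AtomisticToContinuum-CageBudgetFekete`, sub-problem `FouriersLaw`.
BC3 skeleton (skeleton-register, planner one-shot 2026-08-17): three NAMED stubs and the
kernel-checked composition `HeatVarianceCeiling_of` concluding the crux BY NAME.

Arena (inlined verbatim from the route file, shared by every stub): the infinite pinned chain
`pinnedChain ω₂ lam β γ` (`ω₂, lam, β > 0`, any `γ`), `T > 0`, a shift- and momentum-reversal-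
invariant Gibbs state `μ = μ_T`, a `μ`-preserving shift-covariant `D : InfiniteChainDynamics`,
absolutely convergent summed current correlations and `C := t ↦ D.currentCorrelation μ t`
continuous; the crux (C) says: for `V(τ) = 2∫_{(0,τ]} (τ−s) C(s) ds` (equilibrium heat variance,
Einstein–Helfand) `∃ B τ₁, ∀ τ ≥ τ₁, V(τ) ≤ B τ`.

THE LINE — "ceiling = no ballistic channel + no superdiffusive channel, read on the current
spectral measure". Transfer to the frequency side: `C` is of positive type, so `C(t) = ∫ cos(ωt) dρ(ω)`
for a finite measure `ρ` (current spectral measure / a.c. conductivity measure), and then EXACTLY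
`V(τ) = ∫ 2(1 − cos ωτ)/ω² dρ(ω)` (Fejér kernel, value `τ²` at `ω = 0`). The linear ceiling is the
conjunction of two spectrally orthogonal statements at `ω = 0`:
* point spectrum: `ρ({0}) = 0` — NO DRUDE ATOM (no flow-invariant `L²` charge of the infinite chain
  overlaps the total current; Mazur–Suzuki), else `V ≥ ρ({0}) τ²`;
* continuous spectrum: the Poisson means of `ρ` off the atom stay bounded at zero frequency,
  `sup_{0<ν≤1} ∫_{ω≠0} ν/(ν²+ω²) dρ(ω) < ∞` — BOUNDED REGULAR CONDUCTIVITY `Re σ_reg(0 + iν) = O(1)`,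
  the output format of a limiting-absorption / Mourre estimate for the Liouvillian on `(Ker L)^⊥`
  at threshold `0`; it excludes the superdiffusive (FPU-like) scenario `dρ ~ |ω|^{-a} dω`, which has
  no atom but `V ~ τ^{1+a}`.
Composition (pure real analysis, proved below): the pointwise kernel domination
`2(1 − cos ωτ)/ω² ≤ 5 τ · (ν/(ν²+ω²))` at `ν = 1/τ` (from `1 − cos x ≤ x²/2` and `1 − cos x ≤ 2`)
integrates to `V(τ) ≤ 5 τ ∫ ν/(ν²+ω²) dρ = 5 τ ∫_{ω≠0} … ≤ 5 M τ` for `τ ≥ 1` — no decay rate, no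
`L¹` memory, no dyadic decomposition. Why the transfer is EASIER, not a costume: the ceiling
becomes LOCAL at `ω = 0` and splits along the spectral types of `L`; the atom is the business of
the Mazur/hidden-charge engines of this sub (`LatticeLandauDamping.NoDrudeWeight`, stmt-14012, is
the nearest in-tree statement), the continuum bound is a resolvent estimate
`⟨J, ν(ν²+L²)⁻¹ J⟩ ≤ M`, for which positive-commutator tools exist (routes DrudeMourre /
EmbeddedDrudeMourre attack the same resolvent at low `T`); neither piece alone gives (C), and (C)
gives both back (given the Laplace identity of `HeatVarianceCalculus`).

Stubs:
* `stub_positiveType` (infrastructure, M/L, provable now in kind): `C` is even and positive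
  semidefinite over real coefficient vectors — the summed autocorrelation is the spectral function
  of the zero-wavenumber current `J` in the GNS/Doyon space `ℋ₀` (`Σ_x Cov(a, a∘shift^x) =
  lim_L L⁻¹ Var(Σ_{x<L} a∘shift^x) ≥ 0` by absolute summability; evenness from stationarity,
  shift covariance and the a.e. group law). With continuity (arena) the LANDED cosine-Bochner
  theorem `Theorems.MourreDissolution.stub_cosineBochner` turns it into the spectral measure `ρ`.
* `stub_noDrudeAtom` (LOAD-BEARING, open): every finite `ρ` representing `C` has `ρ {0} = 0`.
* `stub_regularPartPoissonBound` (LOAD-BEARING, open): every finite `ρ` representing `C` has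
  bounded Poisson means off the atom for `ν ∈ (0, 1]`.

`HeatVarianceCeiling_of : Sig.stub_positiveType → Sig.stub_noDrudeAtom →
Sig.stub_regularPartPoissonBound → HeatVarianceCeiling` (no sorry): `B = 5M`, `τ₁ = 1`.

File map: §0 pure real analysis (Fejér kernel in closed form, its Poisson domination, Fubini and
the ceiling lemma `heatVariance_le_of_poissonBound`); §1 `Sig.stub_<name> : Prop` — the stub
STATEMENTS (named, so the composition's hypotheses are the declared stubs BY NAME); §2
`theorem stub_<name> : <statement verbatim> := by sorry` — the registered stubs (the ONLY sorries);
§3 `HeatVarianceCeiling_of`; §4 an `example` instantiating it through the sorried stubs.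

Disproof used: none — no `Disproof.lean` / Negative lemma is filed on this crux
(`ledger crux ls stmt-AtomisticToContinuum-15770`: no workfiles, 2026-08-17); the summit's
negatives index (20 entries) has no statement about `currentCorrelation` spectral measures.
Calibration honoured: at the harmonic member `lam = β = 0` (excluded by the arena) `C ≡ C(0) > 0`,
`ρ = C(0) δ₀`, so `stub_noDrudeAtom` is the stub that fails there — exactly where the crux fails
(`Literature.Barriers.AtomisticToContinuum.HarmonicChainBallisticFlux`, Mazur1969_inequality).
-/

open MeasureTheory Filter Set Topology

namespace Summit.AtomisticToContinuum.FouriersLaw.Cruxes.HeatVarianceCeiling.Birth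

open Summit.AtomisticToContinuum.FouriersLaw.Theses.CageBudgetFekete (HeatVarianceCeiling)

/-! ## §0 Pure real analysis: the Fejér kernel is dominated by the Poisson kernel -/

/-- The Fejér-type kernel of the heat variance in closed form, `ω ≠ 0`:
`∫_{(0,τ]} (τ − s) cos(ω s) ds = (1 − cos(ωτ))/ω²`. [folklore] -/
theorem integral_fejerKernel {ω : ℝ} (hω : ω ≠ 0) {τ : ℝ} (hτ : 0 ≤ τ) :
    ∫ s in Set.Ioc (0:ℝ) τ, (τ - s) * Real.cos (ω * s) = (1 - Real.cos (ω * τ)) / ω ^ 2 := by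
  rw [← intervalIntegral.integral_of_le hτ]
  have hderiv : ∀ s : ℝ, HasDerivAt
      (fun s : ℝ => (τ - s) * Real.sin (ω * s) / ω - Real.cos (ω * s) / ω ^ 2)
      ((τ - s) * Real.cos (ω * s)) s := by
    intro s
    have h1 : HasDerivAt (fun s : ℝ => ω * s) ω s := by
      simpa using (hasDerivAt_id' s).const_mul ω
    have hsin : HasDerivAt (fun s : ℝ => Real.sin (ω * s)) (Real.cos (ω * s) * ω) s :=
      (Real.hasDerivAt_sin (ω * s)).comp s h1
    have hcos : HasDerivAt (fun s : ℝ => Real.cos (ω * s)) (-Real.sin (ω * s) * ω) s :=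
      (Real.hasDerivAt_cos (ω * s)).comp s h1
    have hlin : HasDerivAt (fun s : ℝ => τ - s) (-1) s := by
      simpa using (hasDerivAt_id' s).const_sub τ
    have h := ((hlin.fun_mul hsin).div_const ω).fun_sub (hcos.div_const (ω ^ 2))
    refine h.congr_deriv ?_
    rw [div_sub_div _ _ hω (pow_ne_zero 2 hω), div_eq_iff (mul_ne_zero hω (pow_ne_zero 2 hω))]
    ring
  rw [intervalIntegral.integral_eq_sub_of_hasDerivAt (fun s _ => hderiv s)
    (by apply Continuous.intervalIntegrable; fun_prop)]
  simp only [sub_self, zero_mul, mul_zero, Real.sin_zero, Real.cos_zero, zero_div]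
  ring

/-- The Fejér-type kernel at `ω = 0`: `∫_{(0,τ]} (τ − s) ds = τ²/2`. [folklore] -/
theorem integral_fejerKernel_zero {τ : ℝ} (hτ : 0 ≤ τ) :
    ∫ s in Set.Ioc (0:ℝ) τ, (τ - s) * Real.cos (0 * s) = τ ^ 2 / 2 := by
  simp only [zero_mul, Real.cos_zero, mul_one]
  rw [← intervalIntegral.integral_of_le hτ]
  have hderiv : ∀ s : ℝ, HasDerivAt (fun s : ℝ => τ * s - s * s / 2) (τ - s) s := by
    intro s
    have h := ((hasDerivAt_id' s).const_mul τ).fun_sub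
      (((hasDerivAt_id' s).fun_mul (hasDerivAt_id' s)).div_const 2)
    exact h.congr_deriv (by ring)
  rw [intervalIntegral.integral_eq_sub_of_hasDerivAt (fun s _ => hderiv s)
    (by apply Continuous.intervalIntegrable; fun_prop)]
  ring

/-- POISSON DOMINATION OF THE FEJÉR KERNEL: for `τ > 0` and every `ω`,
`∫_{(0,τ]} (τ − s) cos(ω s) ds ≤ (5/2) τ · (ν/(ν²+ω²))` with `ν = τ⁻¹`
(from `1 − cos x ≤ x²/2` and `1 − cos x ≤ 2`: `(1 − cos x)(1 + x²) ≤ (5/2) x²`). [folklore] -/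
theorem fejerKernel_le_poisson {τ : ℝ} (hτ : 0 < τ) (ω : ℝ) :
    ∫ s in Set.Ioc (0:ℝ) τ, (τ - s) * Real.cos (ω * s) ≤
      5 / 2 * τ * (τ⁻¹ / (τ⁻¹ ^ 2 + ω ^ 2)) := by
  have hτ0 : τ ≠ 0 := hτ.ne'
  have hP : τ⁻¹ / (τ⁻¹ ^ 2 + ω ^ 2) = τ / (1 + ω ^ 2 * τ ^ 2) := by
    rw [div_eq_div_iff (by positivity) (by positivity)]
    field_simp
  rw [hP]
  rcases eq_or_ne ω 0 with rfl | hω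
  · rw [integral_fejerKernel_zero hτ.le]
    have h1 : τ / (1 + (0:ℝ) ^ 2 * τ ^ 2) = τ := by simp
    rw [h1]
    nlinarith
  · rw [integral_fejerKernel hω hτ.le]
    rw [show 5 / 2 * τ * (τ / (1 + ω ^ 2 * τ ^ 2)) = (5 / 2 * τ ^ 2) / (1 + ω ^ 2 * τ ^ 2) by ring]
    rw [div_le_iff₀ (by positivity), div_mul_eq_mul_div, le_div_iff₀ (by positivity)]
    have h1 : 1 - (ω * τ) ^ 2 / 2 ≤ Real.cos (ω * τ) := Real.one_sub_sq_div_two_le_cos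
    have h2 : -1 ≤ Real.cos (ω * τ) := Real.neg_one_le_cos (ω * τ)
    have h3 : 0 ≤ (ω * τ) ^ 2 * (1 + Real.cos (ω * τ)) :=
      mul_nonneg (sq_nonneg _) (by linarith)
    nlinarith [h1, h2, h3, sq_nonneg (ω * τ)]

/-- THE CEILING LEMMA (pure analysis). If `C(t) = ∫ cos(ωt) dσ(ω)` for a finite measure `σ` with
no atom at `0` and Poisson means off the atom bounded by `M` for `ν ∈ (0,1]`, then
`2 ∫_{(0,τ]} (τ − s) C(s) ds ≤ 5 M τ` for every `τ ≥ 1` (Fubini + `fejerKernel_le_poisson` at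
`ν = τ⁻¹`). [folklore] -/
theorem heatVariance_le_of_poissonBound (C : ℝ → ℝ) (σ : Measure ℝ) [IsFiniteMeasure σ]
    (hC : ∀ t : ℝ, C t = ∫ ω, Real.cos (ω * t) ∂σ) (h0 : σ {0} = 0) {M : ℝ}
    (hM : ∀ ν : ℝ, 0 < ν → ν ≤ 1 → ∫ ω in ({0} : Set ℝ)ᶜ, ν / (ν ^ 2 + ω ^ 2) ∂σ ≤ M)
    {τ : ℝ} (hτ : 1 ≤ τ) :
    2 * ∫ s in Set.Ioc (0:ℝ) τ, (τ - s) * C s ≤ 5 * M * τ := by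
  have hτ0 : 0 < τ := by linarith
  -- (1) Fubini data for `(s, ω) ↦ (τ - s) cos(ω s)` on `(0,τ] × ℝ`
  have hae : ∀ᵐ p : ℝ × ℝ ∂((volume.restrict (Set.Ioc (0:ℝ) τ)).prod σ), p.1 ∈ Set.Ioc (0:ℝ) τ :=
    (Measure.quasiMeasurePreserving_fst (μ := volume.restrict (Set.Ioc (0:ℝ) τ)) (ν := σ)).ae
      (ae_restrict_mem measurableSet_Ioc)
  have hcont : Continuous (Function.uncurry fun (s ω : ℝ) => (τ - s) * Real.cos (ω * s)) := by
    change Continuous fun p : ℝ × ℝ => (τ - p.1) * Real.cos (p.2 * p.1)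
    fun_prop
  have hint : Integrable (Function.uncurry fun (s ω : ℝ) => (τ - s) * Real.cos (ω * s))
      ((volume.restrict (Set.Ioc (0:ℝ) τ)).prod σ) := by
    refine (integrable_const τ).mono' hcont.aestronglyMeasurable ?_
    filter_upwards [hae] with p hp
    change ‖(τ - p.1) * Real.cos (p.2 * p.1)‖ ≤ τ
    rw [Real.norm_eq_abs, abs_mul]
    have h1 : |τ - p.1| ≤ τ := by
      rw [abs_of_nonneg (by linarith [hp.2])]
      linarith [hp.1]
    exact (mul_le_mul h1 (Real.abs_cos_le_one _) (abs_nonneg _) hτ0.le).trans_eq (mul_one τ)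
  have hK : Integrable (fun ω : ℝ => ∫ s in Set.Ioc (0:ℝ) τ, (τ - s) * Real.cos (ω * s)) σ :=
    hint.integral_prod_right
  -- (2) the Poisson kernel at `ν = τ⁻¹` is `σ`-integrable
  have hPI : Integrable (fun ω : ℝ => τ⁻¹ / (τ⁻¹ ^ 2 + ω ^ 2)) σ := by
    refine (integrable_const τ).mono' ?_ (ae_of_all _ fun ω => ?_)
    · exact (continuous_const.div (by fun_prop)
        (fun ω => (by positivity : τ⁻¹ ^ 2 + ω ^ 2 ≠ 0))).aestronglyMeasurable
    · rw [Real.norm_eq_abs, abs_of_nonneg (by positivity), div_le_iff₀ (by positivity)]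
      have h1 : τ * τ⁻¹ ^ 2 = τ⁻¹ := by
        rw [pow_two, ← mul_assoc, mul_inv_cancel₀ hτ0.ne', one_mul]
      nlinarith [mul_nonneg hτ0.le (sq_nonneg ω)]
  -- (3) elementary facts about `ν = τ⁻¹` and the atom
  have hν0 : 0 < τ⁻¹ := inv_pos.2 hτ0
  have hν1 : τ⁻¹ ≤ 1 := by
    have h1 : τ⁻¹ * τ = 1 := inv_mul_cancel₀ hτ0.ne'
    nlinarith [mul_nonneg hν0.le (show (0:ℝ) ≤ τ - 1 by linarith)]
  have hrestrict : σ.restrict ({0} : Set ℝ)ᶜ = σ :=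
    Measure.restrict_eq_self_of_ae_mem (compl_mem_ae_iff.2 h0)
  have hpt : ∀ ω : ℝ, (∫ s in Set.Ioc (0:ℝ) τ, (τ - s) * Real.cos (ω * s)) ≤
      5 / 2 * τ * (τ⁻¹ / (τ⁻¹ ^ 2 + ω ^ 2)) := fejerKernel_le_poisson hτ0
  -- (4) the chain of (in)equalities
  calc 2 * ∫ s in Set.Ioc (0:ℝ) τ, (τ - s) * C s
      = 2 * ∫ s in Set.Ioc (0:ℝ) τ, ∫ ω, (τ - s) * Real.cos (ω * s) ∂σ := by
        congr 1
        refine setIntegral_congr_fun measurableSet_Ioc fun s _ => ?_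
        rw [hC s, ← integral_const_mul]
    _ = 2 * ∫ ω, (∫ s in Set.Ioc (0:ℝ) τ, (τ - s) * Real.cos (ω * s)) ∂σ := by
        rw [integral_integral_swap hint]
    _ ≤ 2 * ∫ ω, 5 / 2 * τ * (τ⁻¹ / (τ⁻¹ ^ 2 + ω ^ 2)) ∂σ :=
        mul_le_mul_of_nonneg_left (integral_mono hK (hPI.const_mul _) fun ω => hpt ω)
          (by norm_num)
    _ = 5 * τ * ∫ ω, τ⁻¹ / (τ⁻¹ ^ 2 + ω ^ 2) ∂σ := by
        rw [integral_const_mul]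
        ring
    _ = 5 * τ * ∫ ω in ({0} : Set ℝ)ᶜ, τ⁻¹ / (τ⁻¹ ^ 2 + ω ^ 2) ∂σ := by rw [hrestrict]
    _ ≤ 5 * τ * M := mul_le_mul_of_nonneg_left (hM τ⁻¹ hν0 hν1) (by positivity)
    _ = 5 * M * τ := by ring

/-! ## §1 The stub statements (named) -/

/-- Statement of `stub_positiveType` (infrastructure: the summed current autocorrelation of a
guarded symmetric pair is an even function of positive type over real coefficient vectors). -/
def Sig.stub_positiveType : Prop :=
    ∀ ω₂ lam β γ : ℝ, 0 < ω₂ → 0 < lam → 0 < β → ∀ T : ℝ, 0 < T → ∀ μ : MeasureTheory.Measure Literature.MathematicalPhysics.KineticTheory.HeatConduction.ChainConfig, (Literature.MathematicalPhysics.KineticTheory.HeatConduction.pinnedChain ω₂ lam β γ).IsChainGibbsMeasure T μ → Literature.MathematicalPhysics.KineticTheory.HeatConduction.IsShiftInvariant μ → μ.map (fun σ : Literature.MathematicalPhysics.KineticTheory.HeatConduction.ChainConfig => fun x : ℤ => ((σ x).1, -(σ x).2)) = μ → ∀ D : Literature.MathematicalPhysics.KineticTheory.HeatConduction.InfiniteChainDynamics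 (Literature.MathematicalPhysics.KineticTheory.HeatConduction.pinnedChain ω₂ lam β γ), D.PreservesMeasure μ → (∀ t : ℝ, ∀ᵐ σ ∂μ, D.flow t (Literature.MathematicalPhysics.KineticTheory.HeatConduction.shift σ) = Literature.MathematicalPhysics.KineticTheory.HeatConduction.shift (D.flow t σ)) → (∀ t : ℝ, D.HasAbsConvergentCorrelation μ t) → Continuous (fun t : ℝ => D.currentCorrelation μ t) →
      (∀ t : ℝ, D.currentCorrelation μ (-t) = D.currentCorrelation μ t) ∧
        ∀ (n : ℕ) (c τ : Fin n → ℝ), 0 ≤ ∑ i, ∑ j, c i * c j * D.currentCorrelation μ (τ j - τ i)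

/-- Statement of `stub_noDrudeAtom` (LOAD-BEARING: no Drude atom — every finite measure
representing the summed current autocorrelation has no mass at zero frequency). -/
def Sig.stub_noDrudeAtom : Prop :=
    ∀ ω₂ lam β γ : ℝ, 0 < ω₂ → 0 < lam → 0 < β → ∀ T : ℝ, 0 < T → ∀ μ : MeasureTheory.Measure Literature.MathematicalPhysics.KineticTheory.HeatConduction.ChainConfig, (Literature.MathematicalPhysics.KineticTheory.HeatConduction.pinnedChain ω₂ lam β γ).IsChainGibbsMeasure T μ → Literature.MathematicalPhysics.KineticTheory.HeatConduction.IsShiftInvariant μ → μ.map (fun σ : Literature.MathematicalPhysics.KineticTheory.HeatConduction.ChainConfig => fun x : ℤ => ((σ x).1, -(σ x).2)) = μ → ∀ D : Literature.MathematicalPhysics.KineticTheory.HeatConduction.InfiniteChainDynamics (Literature.MathematicalPhysics.KineticTheory.HeatConduction.pinnedChain ω₂ lam β γ), D.PreservesMeasure μ → (∀ t : ℝ, ∀ᵐ σ ∂μ, D.flow t (Literature.MathematicalPhysics.KineticTheory.HeatConduction.shift σ) = Literature.MathematicalPhysics.KineticTheory.HeatConduction.shift (D.flow t σ)) → (∀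 t : ℝ, D.HasAbsConvergentCorrelation μ t) → Continuous (fun t : ℝ => D.currentCorrelation μ t) →
      ∀ ρ : MeasureTheory.Measure ℝ, MeasureTheory.IsFiniteMeasure ρ →
        (∀ t : ℝ, D.currentCorrelation μ t = MeasureTheory.integral ρ (fun ω : ℝ => Real.cos (ω * t))) →
          ρ {0} = 0

/-- Statement of `stub_regularPartPoissonBound` (LOAD-BEARING: the regular part of the current
spectral measure has bounded Poisson means at zero frequency, `ν ∈ (0, 1]`). -/
def Sig.stub_regularPartPoissonBound : Prop :=
    ∀ ω₂ lam β γ : ℝ, 0 < ω₂ → 0 < lam → 0 < β → ∀ T : ℝ, 0 < T → ∀ μ : MeasureTheory.Measure Literature.MathematicalPhysics.KineticTheory.HeatConduction.ChainConfig, (Literature.MathematicalPhysics.KineticTheory.HeatConduction.pinnedChain ω₂ lam β γ).IsChainGibbsMeasure T μ → Literature.MathematicalPhysics.KineticTheory.HeatConduction.IsShiftInvariant μ → μ.map (fun σ : Literature.MathematicalPhysics.KineticTheory.HeatConduction.ChainConfig => fun x : ℤ => ((σ x).1, -(σ x).2)) = μ → ∀ D : Literature.MathematicalPhysics.KineticTheory.HeatConduction.InfiniteChainDynamics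 (Literature.MathematicalPhysics.KineticTheory.HeatConduction.pinnedChain ω₂ lam β γ), D.PreservesMeasure μ → (∀ t : ℝ, ∀ᵐ σ ∂μ, D.flow t (Literature.MathematicalPhysics.KineticTheory.HeatConduction.shift σ) = Literature.MathematicalPhysics.KineticTheory.HeatConduction.shift (D.flow t σ)) → (∀ t : ℝ, D.HasAbsConvergentCorrelation μ t) → Continuous (fun t : ℝ => D.currentCorrelation μ t) →
      ∀ ρ : MeasureTheory.Measure ℝ, MeasureTheory.IsFiniteMeasure ρ →
        (∀ t : ℝ, D.currentCorrelation μ t = MeasureTheory.integral ρ (fun ω : ℝ => Real.cos (ω * t))) →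
          ∃ M : ℝ, ∀ ν : ℝ, 0 < ν → ν ≤ 1 →
            ∫ ω in ({0} : Set ℝ)ᶜ, ν / (ν ^ 2 + ω ^ 2) ∂ρ ≤ M

/-! ## §2 The registered stubs (the only `sorry`s of the file) -/

/-- STUB 1 (infrastructure; size M/L, provable now in kind). THE SUMMED CURRENT AUTOCORRELATION
IS AN EVEN FUNCTION OF POSITIVE TYPE: for every guarded symmetric pair `(μ, D)` of the arena,
`C(−t) = C(t)` and `0 ≤ Σᵢⱼ cᵢ cⱼ C(τⱼ − τᵢ)` for all real `c, τ : Fin n → ℝ`, where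
`C t = D.currentCorrelation μ t = Σ_x ∫ j₀ · (j_x ∘ φ_t) dμ`. Why plausibly true: with
`a := Σᵢ cᵢ j₀ ∘ φ_{τᵢ} ∈ L²(μ)`, measure preservation and the a.e. group law give
`Σᵢⱼ cᵢcⱼ C(τⱼ−τᵢ) = Σ_x ∫ a · (a ∘ shift^x) dμ` (shift covariance of the flow, shift invariance of
`μ`), and absolute summability (arena) makes this the Cesàro limit `lim_L L⁻¹ ‖Σ_{x<L} a∘shift^x‖²
≥ 0`; evenness by the same change of variables. It is the statement that `C` is the spectral
function `⟨J, e^{itL} J⟩_{ℋ₀}` of the zero-wavenumber current in Doyon's Hilbert space. With the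
arena's continuity, the LANDED `Theorems.MourreDissolution.stub_cosineBochner` then yields the
current spectral measure. Why it might fail: only through the a.e. bookkeeping of
`InfiniteChainDynamics` (flow defined off a null set; covariance only a.e.) — no mathematical
obstruction. Leans on: `InfiniteChainDynamics.flow_add`, `PreservesMeasure`, `IsShiftInvariant`,
`HasAbsConvergentCorrelation`; Doyon2022 §5, BonettoLebowitzReyBellet2000 §7 (37), Spohn1991
II.2. -/
theorem stub_positiveType :
    ∀ ω₂ lam β γ : ℝ, 0 < ω₂ → 0 < lam → 0 < β → ∀ T : ℝ, 0 < T → ∀ μ : MeasureTheory.Measure Literature.MathematicalPhysics.KineticTheory.HeatConduction.ChainConfig, (Literature.MathematicalPhysics.KineticTheory.HeatConduction.pinnedChain ω₂ lam β γ).IsChainGibbsMeasure T μ → Literature.MathematicalPhysics.KineticTheory.HeatConduction.IsShiftInvariant μ → μ.map (fun σ : Literature.MathematicalPhysics.KineticTheory.HeatConduction.ChainConfig => fun x : ℤ => ((σ x).1, -(σ x).2)) = μ → ∀ D : Literature.MathematicalPhysics.KineticTheory.HeatConduction.InfiniteChainDynamics (Literature.MathematicalPhysics.KineticTheory.HeatConduction.pinnedChain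 ω₂ lam β γ), D.PreservesMeasure μ → (∀ t : ℝ, ∀ᵐ σ ∂μ, D.flow t (Literature.MathematicalPhysics.KineticTheory.HeatConduction.shift σ) = Literature.MathematicalPhysics.KineticTheory.HeatConduction.shift (D.flow t σ)) → (∀ t : ℝ, D.HasAbsConvergentCorrelation μ t) → Continuous (fun t : ℝ => D.currentCorrelation μ t) →
      (∀ t : ℝ, D.currentCorrelation μ (-t) = D.currentCorrelation μ t) ∧
        ∀ (n : ℕ) (c τ : Fin n → ℝ), 0 ≤ ∑ i, ∑ j, c i * c j * D.currentCorrelation μ (τ j - τ i) := by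
  sorry

/-- STUB 2 (LOAD-BEARING; open — the point spectrum at zero frequency). NO DRUDE ATOM: for every
guarded symmetric pair `(μ, D)` of the arena and every finite measure `ρ` on `ℝ` with
`C(t) = ∫ cos(ωt) dρ(ω)` for all `t`: `ρ({0}) = 0`. Equivalently `τ⁻²V(τ) → 0`, the Cesàro mean
`τ⁻¹ ∫₀^τ C → 0`, the total current has zero projection on the flow-invariant vectors of `ℋ₀`
(Suzuki–Mazur equality: Drude weight = Σ over conserved charges). Why plausibly true: for
`lam, β > 0` no (quasi-)local conserved quantity odd under momentum reversal is known, and the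
pinning destroys momentum conservation; why it might fail: a hidden flow-invariant `L²` charge of
the infinite chain overlapping `J` (Mazur atom) — absence is unproved for any anharmonic
deterministic chain; FALSE at the harmonic member `lam = β = 0` (`ρ = C(0)δ₀`), so `0 < lam`,
`0 < β` are load-bearing. Nearest in-tree statement: `LatticeLandauDamping.NoDrudeWeight`
(stmt-AtomisticToContinuum-14012; arena with `γ > 0` and shift invariance as measure-preserving
shifts) / `HermiteLadder.NoDrudeWeight` (stmt-4638, moot). Leans on: Mazur1969, Suzuki 1971,
Doyon2022 Thm 5.1, decl `Literature.Barriers.AtomisticToContinuum.Mazur1969_inequality`,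
decl `Literature.Barriers.AtomisticToContinuum.MazurBoundBallisticNarrow`, Dhar2008 §4. -/
theorem stub_noDrudeAtom :
    ∀ ω₂ lam β γ : ℝ, 0 < ω₂ → 0 < lam → 0 < β → ∀ T : ℝ, 0 < T → ∀ μ : MeasureTheory.Measure Literature.MathematicalPhysics.KineticTheory.HeatConduction.ChainConfig, (Literature.MathematicalPhysics.KineticTheory.HeatConduction.pinnedChain ω₂ lam β γ).IsChainGibbsMeasure T μ → Literature.MathematicalPhysics.KineticTheory.HeatConduction.IsShiftInvariant μ → μ.map (fun σ : Literature.MathematicalPhysics.KineticTheory.HeatConduction.ChainConfig => fun x : ℤ => ((σ x).1, -(σ x).2)) = μ → ∀ D : Literature.MathematicalPhysics.KineticTheory.HeatConduction.InfiniteChainDynamics (Literature.MathematicalPhysics.KineticTheory.HeatConduction.pinnedChain ω₂ lam β γ), D.PreservesMeasure μ → (∀ t : ℝ, ∀ᵐ σ ∂μ, D.flow t (Literature.MathematicalPhysics.KineticTheory.HeatConduction.shift σ) = Literature.MathematicalPhysics.KineticTheory.HeatConduction.shift (D.flow t σ)) → (∀ t : ℝ, D.HasAbsConvergentCorrelation μ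 t) → Continuous (fun t : ℝ => D.currentCorrelation μ t) →
      ∀ ρ : MeasureTheory.Measure ℝ, MeasureTheory.IsFiniteMeasure ρ →
        (∀ t : ℝ, D.currentCorrelation μ t = MeasureTheory.integral ρ (fun ω : ℝ => Real.cos (ω * t))) →
          ρ {0} = 0 := by
  sorry

/-- STUB 3 (LOAD-BEARING; open — the continuous spectrum at zero frequency). BOUNDED REGULAR
CONDUCTIVITY: for every guarded symmetric pair `(μ, D)` and every finite `ρ` representing `C`,
`∃ M, ∀ ν ∈ (0,1], ∫_{ω ≠ 0} ν/(ν² + ω²) dρ(ω) ≤ M` — the Poisson means of the current spectral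
measure WITH ITS ZERO-FREQUENCY ATOM REMOVED stay bounded as `ν ↓ 0`, i.e.
`Re ⟨J, (ν − iL)⁻¹ J⟩` restricted to `(Ker L)^⊥` is `O(1)`: the regular (a.c. + s.c.) part of the
conductivity does not pile up at `ω = 0`. It excludes the SUPERDIFFUSIVE scenario
`dρ ≍ |ω|^{−a}dω`, `0 < a < 1` (no atom, `V ≍ τ^{1+a}`, momentum-conserving FPU phenomenology),
and says nothing about the atom (an atom is stub 2's business, so neither stub gives the crux
alone). Why plausibly true: pinning gaps the phonon band away from `ω = 0` and kinetic theory
(AokiLukkarinenSpohn2006, LukkarinenSpohn2008) predicts a smooth current spectral density at `0`;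
it is the output format of a limiting-absorption principle / Mourre estimate for the Liouvillian
at threshold `0` (routes DrudeMourre, EmbeddedDrudeMourre attack this resolvent at low `T`). Why
it might fail: slow (breather / soliton-like) relaxation channels giving `Re σ_reg(ω) → ∞` as
`ω → 0` without an atom (anomalous but non-ballistic transport), as in momentum-conserving chains
(`κ ~ N^{1/3}`); nothing rigorous bounds the low-frequency conductivity of a deterministic
anharmonic chain. Leans on: BonettoLebowitzReyBellet2000 §7, Dhar2008, LepriLiviPoliti2003,
Spohn2014 (nonlinear fluctuating hydrodynamics), decl
`Literature.Barriers.AtomisticToContinuum.HasBoundedResponse`. -/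
theorem stub_regularPartPoissonBound :
    ∀ ω₂ lam β γ : ℝ, 0 < ω₂ → 0 < lam → 0 < β → ∀ T : ℝ, 0 < T → ∀ μ : MeasureTheory.Measure Literature.MathematicalPhysics.KineticTheory.HeatConduction.ChainConfig, (Literature.MathematicalPhysics.KineticTheory.HeatConduction.pinnedChain ω₂ lam β γ).IsChainGibbsMeasure T μ → Literature.MathematicalPhysics.KineticTheory.HeatConduction.IsShiftInvariant μ → μ.map (fun σ : Literature.MathematicalPhysics.KineticTheory.HeatConduction.ChainConfig => fun x : ℤ => ((σ x).1, -(σ x).2)) = μ → ∀ D : Literature.MathematicalPhysics.KineticTheory.HeatConduction.InfiniteChainDynamics (Literature.MathematicalPhysics.KineticTheory.HeatConduction.pinnedChain ω₂ lam β γ), D.PreservesMeasure μ → (∀ t : ℝ, ∀ᵐ σ ∂μ, D.flow t (Literature.MathematicalPhysics.KineticTheory.HeatConduction.shift σ) = Literature.MathematicalPhysics.KineticTheory.HeatConduction.shift (D.flow t σ)) → (∀ t : ℝ, D.HasAbsConvergentCorrelation μ t) → Continuous (fun t : ℝ => D.currentCorrelation μ t) →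
      ∀ ρ : MeasureTheory.Measure ℝ, MeasureTheory.IsFiniteMeasure ρ →
        (∀ t : ℝ, D.currentCorrelation μ t = MeasureTheory.integral ρ (fun ω : ℝ => Real.cos (ω * t))) →
          ∃ M : ℝ, ∀ ν : ℝ, 0 < ν → ν ≤ 1 →
            ∫ ω in ({0} : Set ℝ)ᶜ, ν / (ν ^ 2 + ω ^ 2) ∂ρ ≤ M := by
  sorry

/-! ## §3 The composition -/

/-- COMPOSITION (kernel-checked, no sorry): the three stubs, BY NAME, give the crux
`Summit.AtomisticToContinuum.FouriersLaw.Theses.CageBudgetFekete.HeatVarianceCeiling`.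
Proof: positive type + continuity (arena) ⟹ spectral measure `ρ` (landed cosine-Bochner theorem
`Theorems.MourreDissolution.stub_cosineBochner`); stub 2 kills the atom, stub 3 bounds the Poisson
means off the atom by `M`; `heatVariance_le_of_poissonBound` gives `V(τ) ≤ 5Mτ` for `τ ≥ 1`, i.e.
the crux with `B = 5M`, `τ₁ = 1`. -/
theorem HeatVarianceCeiling_of :
    Sig.stub_positiveType → Sig.stub_noDrudeAtom → Sig.stub_regularPartPoissonBound →
      HeatVarianceCeiling := by
  intro h1 h2 h3 ω₂ lam β γ hω hl hβ T hT μ hG hSI hR D hP hSh hAC hCc V hV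
  obtain ⟨heven, hpsd⟩ := h1 ω₂ lam β γ hω hl hβ T hT μ hG hSI hR D hP hSh hAC hCc
  obtain ⟨ρ, hfin, hrep⟩ :=
    Summit.AtomisticToContinuum.FouriersLaw.Theorems.MourreDissolution.stub_cosineBochner
      (fun t : ℝ => D.currentCorrelation μ t) hCc heven hpsd
  have h0 : ρ {0} = 0 := h2 ω₂ lam β γ hω hl hβ T hT μ hG hSI hR D hP hSh hAC hCc ρ hfin hrep
  obtain ⟨M, hM⟩ := h3 ω₂ lam β γ hω hl hβ T hT μ hG hSI hR D hP hSh hAC hCc ρ hfin hrep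
  refine ⟨5 * M, 1, fun τ hτ => ?_⟩
  subst hV
  haveI : MeasureTheory.IsFiniteMeasure ρ := hfin
  show 2 * ∫ s in Set.Ioc (0:ℝ) τ, (τ - s) * D.currentCorrelation μ s ≤ 5 * M * τ
  exact heatVariance_le_of_poissonBound (fun t : ℝ => D.currentCorrelation μ t) ρ hrep h0 hM hτ

/-! ## §4 Instantiation through the sorried stubs (an `example`: registers nothing and leaves
`HeatVarianceCeiling_of` the unique declaration concluding the crux) -/

example : HeatVarianceCeiling :=
  HeatVarianceCeiling_of stub_positiveType stub_noDrudeAtom stub_regularPartPoissonBound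

end Summit.AtomisticToContinuum.FouriersLaw.Cruxes.HeatVarianceCeiling.Birth
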